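import Mathlib
import Summits.Ventures.PercRepro2.HCov
import Summits.Ventures.PercRepro2.GcSkelRules
import Summits.Ventures.PercRepro2.GcSkelReductionT
import Summits.Ventures.PercRepro2.GcSkelReductionMin
import Summits.Ventures.PercRepro2.GcSkelReductionO
import Summits.Ventures.PercRepro2.GcSkelReductionOB
import Summits.Ventures.PercRepro2.GcSkelReductionMinOB
import Summits.Ventures.PercRepro2.GcSkelReductionH
import Summits.Ventures.PercRepro2.GcSkelReductionMinH
import Summits.Ventures.PercRepro2.GcSkelReductionActive
import Summits.Ventures.PercRepro2.GcSkelReductionBounded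
import Summits.Ventures.PercRepro2.GcSkelReductionZ
import Summits.Ventures.PercRepro2.GcTransport
import Summits.Ventures.PercRepro2.A3RootEdgeAll
import Summits.Ventures.PercRepro2.GcRootPair
import Summits.Ventures.PercRepro2.GcInterior
import Summits.Ventures.PercRepro2.GcRational
import Summits.Ventures.PercRepro2.GcHatConn
import Summits.Ventures.PercRepro2.GcHatClosure

/-!
# The residual with no hat (blind cell PercRepro2, typer-1 g56)

A HAT is an unmarked vertex `u` whose non-loop edges are exactly `{u, a₁}`, `{u, a₂}` and `{u, w}`
(`Hat.IsHatAt`). At interior weights the hat is an exact REDUCTION of the weighted calculus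
(`GcHat.lean` / `GcHatClosure.lean`): `Gc` is `c³` times `Gc` of the hat graph — `u` isolated, the
two patterns `a₁ – w`, `a₂ – w` on independent edges — under the hat weights, with `c > 0`, and the
hat graph has one non-loop edge fewer. The weighted twin of the typed lane's «hat» kill.

Folded into the class of record through the size-bounded residual theorem, with the interior
reduction (`HCov_of_int`) inserted at the base — every instance is decided at interior weights,
where the hat reduction applies:

* **`HasHat`**, **`WReducedMinHAZH`** := `WReducedMinHAZ` ∧ no hat (30 clauses), the closures
  `HCovWRedMinHAZH_int_le` / `HCovWRedMinHAZH_int_all` / `HCovWRedMinHAZH_all`;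
* **`HCov_of_HCovWRedMinHAZH_int_le`** — the strong induction on `nonLoopCard` over all graphs;
* **`HCov_all_iff_HCovWRedMinHAZH_int_all`**, **`HCov_all_iff_HCovWRedMinHAZH_all`**,
  **`HCov_all_real_iff_HCovWRedMinHAZH_int_all_rat`** — THE STATEMENT OF RECORD: the crux over
  `ℝ` is (HCOV) on the class of record with no hat, at rational interior weights. On it every
  unmarked vertex adjacent to both roots carries at least two further non-loop edges.

Standard axioms.
-/

namespace Summit.Ventures.PercRepro2

open CovForm RECM

namespace WRed

/-! ## The class -/

section ClassH

variable {V : Type*} {E : Type*} [Fintype E] [DecidableEq E] [DecidableEq V]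

/-- **A hat at an unmarked vertex**: `u` unmarked, its non-loop edges exactly `{u, a₁}`, `{u, a₂}`
and `{u, w}`. -/
def HasHat (ends : E → Sym2 V) (o a₁ a₂ a₃ b : V) : Prop :=
  ∃ (u w : V) (e₁ e₂ e₃ : E), Unmarked o a₁ a₂ a₃ b u ∧ Hat.IsHatAt ends u a₁ a₂ w e₁ e₂ e₃

/-- **The class of record with no hat**: `WReducedMinHAZ` and no hat. -/
structure WReducedMinHAZH (ends : E → Sym2 V) (o a₁ a₂ a₃ b : V) : Prop
    extends WReducedMinHAZ ends o a₁ a₂ a₃ b where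
  /-- no unmarked vertex has exactly the non-loop edges to `a₁`, `a₂` and one further vertex -/
  noHat : ¬ HasHat ends o a₁ a₂ a₃ b

end ClassH

section ClosureH

variable (R : Type*) [Field R] [LinearOrder R] [IsStrictOrderedRing R]

/-- **(HCOV) on the class of record with no hat, at interior weights, at most `N` non-loop
edges.** -/
def HCovWRedMinHAZH_int_le (N : ℕ) : Prop :=
  ∀ (V E : Type) [Fintype V] [DecidableEq V] [Fintype E] [DecidableEq E]
    (ends : E → Sym2 V), nonLoopCard ends ≤ N → ∀ (p : E → R), IsIntVec p →
    ∀ o a₁ a₂ a₃ b : V, a₁ ≠ a₂ → a₁ ≠ a₃ → a₂ ≠ a₃ → o ≠ a₁ → o ≠ a₂ → o ≠ a₃ → o ≠ b →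
      b ≠ a₁ → b ≠ a₂ → b ≠ a₃ → WReducedMinHAZH ends o a₁ a₂ a₃ b → HCov p ends o a₁ a₂ a₃ b

/-- **(HCOV) on the class of record with no hat, at interior weights.** -/
def HCovWRedMinHAZH_int_all : Prop :=
  ∀ (V E : Type) [Fintype V] [DecidableEq V] [Fintype E] [DecidableEq E]
    (ends : E → Sym2 V) (p : E → R), IsIntVec p →
    ∀ o a₁ a₂ a₃ b : V, a₁ ≠ a₂ → a₁ ≠ a₃ → a₂ ≠ a₃ → o ≠ a₁ → o ≠ a₂ → o ≠ a₃ → o ≠ b →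
      b ≠ a₁ → b ≠ a₂ → b ≠ a₃ → WReducedMinHAZH ends o a₁ a₂ a₃ b → HCov p ends o a₁ a₂ a₃ b

/-- **(HCOV) on the class of record with no hat.** -/
def HCovWRedMinHAZH_all : Prop :=
  ∀ (V E : Type) [Fintype V] [DecidableEq V] [Fintype E] [DecidableEq E]
    (ends : E → Sym2 V) (p : E → R), IsProbVec p →
    ∀ o a₁ a₂ a₃ b : V, a₁ ≠ a₂ → a₁ ≠ a₃ → a₂ ≠ a₃ → o ≠ a₁ → o ≠ a₂ → o ≠ a₃ → o ≠ b →
      b ≠ a₁ → b ≠ a₂ → b ≠ a₃ → WReducedMinHAZH ends o a₁ a₂ a₃ b → HCov p ends o a₁ a₂ a₃ b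

end ClosureH

section MainH

variable {R : Type*} [Field R] [LinearOrder R] [IsStrictOrderedRing R]

/-- **The reduction to the class of record with no hat**, size-bounded: strong induction on
`nonLoopCard` over all graphs; at each size the bounded residual theorem is fed the `WReducedT`
instances, decided at interior weights (`HCov_of_int`): an edge among the roots is looped, a hat
is collapsed (one non-loop edge fewer — the induction hypothesis), the star / hub / active-vertex
class theorems apply, or the instance is in `WReducedMinHAZH`. -/
theorem HCov_of_HCovWRedMinHAZH_int_le (N : ℕ) (hZ : HCovWRedMinHAZH_int_le R N) (n : ℕ) :
    n ≤ N → ∀ (V E : Type) [Fintype V] [DecidableEq V] [Fintype E] [DecidableEq E]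
      (ends : E → Sym2 V), nonLoopCard ends ≤ n → ∀ (p : E → R), IsProbVec p →
      ∀ o a₁ a₂ a₃ b : V, a₁ ≠ a₂ → a₁ ≠ a₃ → a₂ ≠ a₃ → o ≠ a₁ → o ≠ a₂ → o ≠ a₃ → o ≠ b →
        b ≠ a₁ → b ≠ a₂ → b ≠ a₃ → HCov p ends o a₁ a₂ a₃ b := by
  induction n using Nat.strong_induction_on with
  | _ n ih =>
  intro hnN
  refine HCov_of_HCovWRedT_le n ?_
  intro V E _ _ _ _ ends hle p hp o a₁ a₂ a₃ b h12 h13 h23 ho1 ho2 ho3 hob hb1 hb2 hb3 hT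
  -- decide the instance at interior weights
  refine HCov_of_int ends o a₁ a₂ a₃ b (fun q hq => ?_) p hp
  -- an edge among the roots: loop it, one non-loop edge fewer
  by_cases hZe : ∃ e, IsRootsEdge ends a₁ a₂ a₃ e
  · obtain ⟨e, he⟩ := hZe
    rcases he with he | he
    · have hlt : nonLoopCard (Function.update ends e s(a₁, a₁)) < n :=
        lt_of_lt_of_le (nonLoopCard_update_loop_lt ends
          (by rw [he, Sym2.mk_isDiag_iff]; exact h12) a₁) hle
      exact RootPair.HCov_of_loop_of_rootPair q hq.isProbVec he o a₃ b
        (ih _ hlt (le_trans hlt.le hnN) V E _ le_rfl q hq.isProbVec o a₁ a₂ a₃ b h12 h13 h23 ho1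
          ho2 ho3 hob hb1 hb2 hb3)
    · have hlt : nonLoopCard (Function.update ends e s(a₃, a₃)) < n :=
        lt_of_lt_of_le (nonLoopCard_update_loop_lt ends (not_isDiag_of_isRootEdge h13 h23 he) a₃)
          hle
      exact HCov_of_loop_of_isRootEdge he q hq.isProbVec
        (ih _ hlt (le_trans hlt.le hnN) V E _ le_rfl q hq.isProbVec o a₁ a₂ a₃ b h12 h13 h23 ho1
          ho2 ho3 hob hb1 hb2 hb3)
  -- a hat: collapse it, one non-loop edge fewer
  by_cases hH : HasHat ends o a₁ a₂ a₃ b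
  · obtain ⟨u, w, e₁, e₂, e₃, hu, hhat⟩ := hH
    have hlt : nonLoopCard (Hat.hatGraph ends a₁ a₂ w e₁ e₂ e₃) < n :=
      lt_of_lt_of_le (Hat.nonLoopCard_hatGraph_lt hhat) hle
    exact Hat.HCov_of_hat hq hhat hu.1.symm hu.2.2.2.1.symm hu.2.2.2.2.symm
      (ih _ hlt (le_trans hlt.le hnN) V E _ le_rfl _ (Hat.isProbVec_hatWeights_of_int hq e₁ e₂ e₃)
        o a₁ a₂ a₃ b h12 h13 h23 ho1 ho2 ho3 hob hb1 hb2 hb3)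
  -- the class theorems on `(ends, marks)`
  have hMin : WReducedMin ends o a₁ a₂ a₃ b := wredT_iff_wredMin.1 hT
  by_cases hO : OToMarks ends o a₁ a₂ b
  · exact HCov_of_oToMarks hMin.simple hO ho1 ho2 ho3 hob h12 hb1 hb2 q hq.isProbVec
  by_cases hBs : OToMarks ends b a₁ a₂ o
  · exact HCov_of_bToMarks hMin.simple hBs hb1 hb2 hb3 hob h12 ho1 ho2 q hq.isProbVec
  by_cases hOA : OTwoToMarks ends o a₃ b
  · exact HCov_of_oA3BToMarks hMin.simple hOA ho1 ho2 ho3 hob h13 hb1 hb3 q hq.isProbVec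
  by_cases hPH : PoleHubToMarks ends o a₁ a₂ a₃ b
  · exact HCov_of_poleHubToMarks hMin.simple hPH ho1 ho2 ho3 hob h12 h13 hb1.symm h23 hb2.symm
      hb3.symm q hq.isProbVec
  by_cases hA : OneActiveUnmarked ends o a₁ a₂ a₃ b
  · exact HCov_of_oneActiveUnmarked hA q hq.isProbVec
  -- the class of record with no hat
  push Not at hZe
  exact hZ V E ends (le_trans hle hnN) q hq o a₁ a₂ a₃ b h12 h13 h23 ho1 ho2 ho3 hob hb1 hb2 hb3
    ⟨⟨⟨⟨⟨hMin, hO, hBs, hOA⟩, hPH⟩, hA⟩, hZe⟩, hH⟩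

omit [IsStrictOrderedRing R] in
/-- The closure gives every bound. -/
theorem HCovWRedMinHAZH_int_le_of_all (h : HCovWRedMinHAZH_int_all R) (N : ℕ) :
    HCovWRedMinHAZH_int_le R N :=
  fun V E _ _ _ _ ends _ p hp o a₁ a₂ a₃ b h12 h13 h23 ho1 ho2 ho3 hob hb1 hb2 hb3 hred =>
    h V E ends p hp o a₁ a₂ a₃ b h12 h13 h23 ho1 ho2 ho3 hob hb1 hb2 hb3 hred

/-- **THE CLASS OF RECORD WITH NO HAT**: (HCOV) for every finite weighted graph with five
distinct marks follows from (HCOV) on `WReducedMinHAZH` at interior weights. -/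
theorem HCov_all_of_HCovWRedMinHAZH_int_all (hZ : HCovWRedMinHAZH_int_all R) : HCov_all R := by
  intro V E _ _ _ _ ends p hp o a₁ a₂ a₃ b h12 h13 h23 ho1 ho2 ho3 hob hb1 hb2 hb3
  exact HCov_of_HCovWRedMinHAZH_int_le _ (HCovWRedMinHAZH_int_le_of_all hZ _) _ le_rfl V E ends
    le_rfl p hp o a₁ a₂ a₃ b h12 h13 h23 ho1 ho2 ho3 hob hb1 hb2 hb3

omit [IsStrictOrderedRing R] in
/-- The crux gives the closure. -/
theorem HCovWRedMinHAZH_int_all_of_HCov_all (h : HCov_all R) : HCovWRedMinHAZH_int_all R :=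
  fun V E _ _ _ _ ends p hp o a₁ a₂ a₃ b h12 h13 h23 ho1 ho2 ho3 hob hb1 hb2 hb3 _ =>
    h V E ends p hp.isProbVec o a₁ a₂ a₃ b h12 h13 h23 ho1 ho2 ho3 hob hb1 hb2 hb3

/-- **THE CRUX ON THE CLASS OF RECORD WITH NO HAT, AT INTERIOR WEIGHTS**:
`HCov_all ↔ HCovWRedMinHAZH_int_all`. -/
theorem HCov_all_iff_HCovWRedMinHAZH_int_all : HCov_all R ↔ HCovWRedMinHAZH_int_all R :=
  ⟨HCovWRedMinHAZH_int_all_of_HCov_all, HCov_all_of_HCovWRedMinHAZH_int_all⟩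

omit [IsStrictOrderedRing R] in
/-- The closure at every weight gives the interior closure. -/
theorem HCovWRedMinHAZH_int_all_of_all (h : HCovWRedMinHAZH_all R) : HCovWRedMinHAZH_int_all R :=
  fun V E _ _ _ _ ends p hp o a₁ a₂ a₃ b h12 h13 h23 ho1 ho2 ho3 hob hb1 hb2 hb3 hred =>
    h V E ends p hp.isProbVec o a₁ a₂ a₃ b h12 h13 h23 ho1 ho2 ho3 hob hb1 hb2 hb3 hred

/-- **THE CRUX ON THE CLASS OF RECORD WITH NO HAT**: `HCov_all ↔ HCovWRedMinHAZH_all`. -/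
theorem HCov_all_iff_HCovWRedMinHAZH_all : HCov_all R ↔ HCovWRedMinHAZH_all R :=
  ⟨fun h V E _ _ _ _ ends p hp o a₁ a₂ a₃ b h12 h13 h23 ho1 ho2 ho3 hob hb1 hb2 hb3 _ =>
      h V E ends p hp o a₁ a₂ a₃ b h12 h13 h23 ho1 ho2 ho3 hob hb1 hb2 hb3,
    fun h => HCov_all_of_HCovWRedMinHAZH_int_all (HCovWRedMinHAZH_int_all_of_all h)⟩

end MainH

section Real

/-- **THE STATEMENT OF RECORD**: the crux over `ℝ` is (HCOV) on the class of record with no hat,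
at rational weights in `(0, 1)^E`. -/
theorem HCov_all_real_iff_HCovWRedMinHAZH_int_all_rat :
    HCov_all ℝ ↔ HCovWRedMinHAZH_int_all ℚ :=
  HCov_all_real_iff_rat.trans (HCov_all_iff_HCovWRedMinHAZH_int_all (R := ℚ))

end Real

end WRed

end Summit.Ventures.PercRepro2
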